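import Literature.NumberTheory.DiophantineGeometry.EllArithGlue
import Literature.NumberTheory.EllipticCurves.GlobalMinimalModelProofs
import HarnessLib

/-!
# Glue `IsGloballyMinimal` ↔ `IsMinimalAt` at every finite place (proof)

Sibling *proofs* file (theorems only: no definition, no named fact, no instance) of
`Literature.NumberTheory.DiophantineGeometry.EllArithGlue`, discharging the named fact
`WeierstrassCurve.isGloballyMinimal_iff_forall_isMinimalAt` stated there (D-0014): a Weierstrass
equation `W` over a number field `K` is globally minimal (`WeierstrassCurve.IsGloballyMinimal`:
coefficients in `𝓞 K` and `W / K_v` minimal over `𝓞_v` for every finite place `v`) iff it is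
minimal at every finite place (`WeierstrassCurve.IsMinimalAt`).

Silverman, *The Arithmetic of Elliptic Curves*, 2nd ed. (2009), VIII.8, the definition preceding
Prop. 8.2 (*"a global minimal Weierstrass equation for `E/K`" is one that is minimal at every `v`*,
PDF p. 212). The direction `→` is the field `IsGloballyMinimal.isMinimal`; the direction `←` needs
only that an equation which is `v`-integral at every finite place `v` has coefficients in `𝓞 K`
(integrality over the Dedekind domain `𝓞 K` is a local property, `𝓞 K = ⋂_v (K ∩ 𝓞_v)`, Mathlib's
`IsDedekindDomain.HeightOneSpectrum.mem_integers_of_valuation_le_one`), which the tree already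
proves as `WeierstrassCurve.isIntegral_ringOfIntegers_of_forall_isMinimalAt`
(`GlobalMinimalModelProofs`). A separate leaf file is used to keep the import graph of
`EllArithGlue` unchanged.

## References

* [SilvermanAEC2009] J. H. Silverman, *The Arithmetic of Elliptic Curves*, GTM 106, 2nd ed.
  (2009): VIII.8, definition of a global minimal Weierstrass equation (PDF p. 212).
-/

noncomputable section

namespace WeierstrassCurve

open NumberField IsDedekindDomain

variable {K : Type*} [Field K] [NumberField K]

/-- **Discharge of the named fact `WeierstrassCurve.isGloballyMinimal_iff_forall_isMinimalAt`**
(`EllArithGlue.lean`): a Weierstrass equation over a number field is globally minimal iff it is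
minimal at every finite place. `→`: the field `IsGloballyMinimal.isMinimal`; `←`: integrality over
`𝓞 K` from `v`-integrality at every finite `v`
(`isIntegral_ringOfIntegers_of_forall_isMinimalAt`). Silverman, *AEC* VIII.8, definition before
Prop. 8.2. [cite: SilvermanAEC2009, VIII.8 Definition (PDF p. 212)] -/
theorem isGloballyMinimal_iff_forall_isMinimalAt_holds :
    isGloballyMinimal_iff_forall_isMinimalAt (K := K) := fun W ↦
  ⟨fun hW v ↦ hW.isMinimal v, fun h ↦ ⟨isIntegral_ringOfIntegers_of_forall_isMinimalAt W h, h⟩⟩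

end WeierstrassCurve
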